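/-
Copyright (c) 2026 the pub-hodgecm-mathlib formalisation cell (harness21).  Prover seat hodgecm-mathlib-K2Liu-p05 (g3), 2026-09-04
(Track B «K2-LIT», crux hLiu418 = stmt-HodgeConjecture-24832, socket #42F′, ROAD I v3, organ G2-Weil, bridge (G2-W4) part W4-ii (reduction):
the Siegel–Weil section along an archimedean translate is `η_t(k)` times a CONTINUOUS LINEAR FUNCTIONAL of Folland's section — the scalar shell
around (W4-i)).
-/
import Summits.HodgeConjecture.HodgeConjecture.Theorems.K2LiuDoubledWeilRepArchPinned      -- ★ p858249 (W4a): `omega_sD_archToAdelic_tmul`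
import Literature.NumberTheory.K2Lit.SiegelWeilSectionLine                                 -- ★ `swSection`
import Literature.NumberTheory.GelbartRogawski1991.DoubledUnitarySiegelParabolicAlgebra    -- ★ `opD_mul`
import Literature.NumberTheory.Weil1964.AdelicThetaWitness                                 -- ★ `piArch_zero`, `piFinite_zero`
import Summits.HodgeConjecture.HodgeConjecture.Theorems.K2LiuArchOneParameterOrbitDefs    -- ★ `archEmb` (= `archToAdelic`, typed into the subgroup `HA`)
import HarnessLib

/-!
# (G2-W4-ii, reduction) `f_Φ(h · k_∞) = η_t(k) · ℓ_{h,f}(Folland's section (k) a)` for `Φ = a ⊗ f`, with `ℓ_{h,f}` a CONTINUOUS linear functional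

Track B ∕ K2-LIT, hLiu418 = stmt-HodgeConjecture-24832, #42F′ ROAD I v3 organ G2-Weil, bridge (G2-W4) (LEAD F0P6-plan (g12) RULING M-156j (3): W4-ii
«`T := ev₀ ∘ ω(sD h) ∘ (· ⊗ Φ_f)` … ⇒ `hasDerivAt_swSection_arch_orbit` for `doubledWeilRep` BY NAME»).  Namespace
`Summit.HodgeConjecture.HodgeConjecture.Cruxes.HLiu418.K2LiuSwSectionArchOrbit`.  THEOREMS ONLY (no definition, no instance, no notation, no named fact,
no `sorry`); `--supports stmt-HodgeConjecture-24832 --as helper`.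

The Siegel–Weil section of the tree is `swSection sD Φ h = (ω(r_F(δ) · sD h) Φ)(0)` (★ `K2Lit.SiegelWeilSectionLine`), `sD` ANY `χ`-normalised doubled
Weil representation (★ `IsDoubledWeilRep χ sD`; e.g. ★ `doubledWeilRep χ`).  Differentiating `t ↦ f_Φ(h · k_∞(t))` along an archimedean one-parameter
subgroup needs two reductions, both recorded here ONCE in the currency of ★ p858249:

* §1 **`exists_clm_eval_zero_tmul`** (generic, any number field `F`, any index type `ι`) — for an LF-CONTINUOUS operator `M` of the adelic
  Schwartz–Bruhat space (★ `AdelicSchwartzBruhatLF.IsLFContinuous`; EVERY `ω(p)`, `p ∈ Mp_ψ(W_𝔸)ᶜᵒⁿᵗ`, is one: ★ `adelicMpCont.isLFContinuous_omega`) and a finite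
  Schwartz–Bruhat vector `f`, the functional `a ↦ (M (a ⊗ f))(0)` on `𝓢(X_∞)` IS a continuous linear functional `ℓ` (the finite continuous expansion
  `M (a ⊗ f) = ∑ⱼ Aⱼ a ⊗ Ψⱼ` evaluated at `0`: `ℓ = ∑ⱼ Ψⱼ(0) · ev₀ ∘ Aⱼ`);
* §2 **`swSection_tmul_mul_archToAdelic`** — for `IsDoubledWeilRep χ sD` (`χ` unitary, `χ|_{𝕀_{L⁺}} = ε`, odd unitary archimedean type `(t, 0)`), `h ∈ H(𝔸)`,
  `k ∈ H(L⁺ ⊗ ℝ)`, `a ∈ 𝓢(X_∞)`, `f ∈ 𝒮(X_f)`: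
  `swSection sD (a ⊗ f) (h · k) = η_t(k) · (ω(r_F(δ) · sD h) ((Cₖ a) ⊗ f))(0)`, `Cₖ a = (frame conj of (archWeilSectionS k).1.2) a` (★ `opD_mul`, ★
  `omega_sD_archToAdelic_tmul`); hence **`exists_clm_swSection_tmul_mul_archToAdelic`** — ONE continuous linear functional `ℓ = ℓ_{h,f}` on `𝓢(X_∞)` with
  `swSection sD (a ⊗ f) (h · k) = η_t(k) · ℓ (Cₖ a)` for ALL `k` and `a`.
So `t ↦ f_{a ⊗ f}(h · k_∞(t))` is (a smooth character) × (a continuous linear functional of Folland's section orbit `t ↦ C_{k(t)} a`), and the latter is `C^∞`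
along `U(2,2)` at a real place on product vectors by (W4-i) ★∕📤 `K2LiuArchSectionPlaceJunction.contDiffAt_archSectionRepJ_placeSecJ` — the assembly
(`contDiffAt_swSection_…`, then `hasDerivAt_swSection_arch_orbit`) is the sequel.

HONEST LABEL: HC_CM is proved only modulo the 7 printed citations (2 remaining named inputs: hLiu418 = stmt-HodgeConjecture-24832, h413 =
stmt-HodgeConjecture-24833) until rung 0 closes; organ capital for #42F′'s Road I, moves no counter.

## References
* [Weil1964] A. Weil, Acta Math. 111 (1964), Chap. I n° 11 pp. 155–156 (the inductive-limit topology of `𝒮`), Chap. III n° 38–39 p. 189.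
* [GelbartRogawski1991] S. Gelbart, J. Rogawski, Invent. Math. 105 (1991), §3.1 Prop. 3.1.1 p. 455.
* [KudlaRallis1994] S. Kudla, S. Rallis, Ann. of Math. 140 (1994), §1 (Siegel–Weil sections).
* [Paul1998] A. Paul, J. Funct. Anal. 159 (1998), §1.2 (1.2.1)–(1.2.2) p. 389.
-/

set_option autoImplicit false
set_option linter.dupNamespace false
-- the doubled metaplectic carrier `Mp(𝕎^𝔻)ᶜᵒⁿᵗ` elaborates slowly (cf. ★ `SiegelWeilSectionLine`, ★ `opD_mul`: 800 000–2 000 000 heartbeats)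
set_option maxHeartbeats 2000000

noncomputable section

open scoped Classical
open scoped Matrix Kronecker TensorProduct SchwartzMap
open NumberField NumberField.InfinitePlace NumberField.mixedEmbedding IsDedekindDomain
open Literature.RepresentationTheory.HeisenbergGroup
open Literature.NumberTheory.Automorphic Literature.NumberTheory.Automorphic.UnitaryGroup
open Literature.NumberTheory.Weil1964
open Literature.RepresentationTheory.HarrisKudlaSweet1996
open Literature.NumberTheory.GaloisRepresentations
open Literature.NumberTheory.GelbartRogawski1991 Literature.NumberTheory.GelbartRogawski1991.UnitaryDualPair
open Literature.NumberTheory.GelbartRogawski1991.UnitaryDualPair.LocalSplitting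
open Literature.NumberTheory.GelbartRogawski1991.GRConstruction
open Literature.NumberTheory.K2Lit.SiegelDoubled
open Summit.HodgeConjecture.HodgeConjecture.Cruxes.HLiu418.K2LiuDoubledWeilRepArchPinned
open Summit.HodgeConjecture.HodgeConjecture.Cruxes.HLiu418 (K2LiuArchOneParameterOrbitDefs.archEmb K2LiuArchOneParameterOrbitDefs.archEmb_eq_archToAdelic)

namespace Summit.HodgeConjecture.HodgeConjecture.Cruxes.HLiu418.K2LiuSwSectionArchOrbit

/-! ## §1 Generic: evaluation at `0` of an LF-continuous operator on a Fréchet piece is a continuous linear functional -/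

section Generic

variable {F : Type} [Field F] [NumberField F] {ι : Type} [Fintype ι]

/-- **`a ↦ (M (a ⊗ f))(0)` is a continuous linear functional on `𝓢(X_∞)`** for every LF-continuous `M` and every `f ∈ 𝒮(X_f)`: with the finite
continuous expansion `M (a ⊗ f) = ∑ⱼ Aⱼ a ⊗ Ψⱼ` (★ `IsLFContinuous`), `ℓ = ∑ⱼ Ψⱼ(0) · (ev₀ ∘ Aⱼ)` (★ `coe_piSchwartzBruhatEquiv_tmul_apply`).
[cite: Weil1964, Chap. I n° 11 pp. 155–156] -/
theorem exists_clm_eval_zero_tmul {M : ↥(piSchwartzBruhat F ι) →ₗ[ℂ] ↥(piSchwartzBruhat F ι)} (hM : IsLFContinuous M) (f : FinSB F ι) :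
    ∃ ℓ : 𝓢((ι → mixedSpace F), ℂ) →L[ℂ] ℂ, ∀ a : 𝓢((ι → mixedSpace F), ℂ),
      ((M (piSchwartzBruhatEquiv F ι (a ⊗ₜ[ℂ] f)) : ↥(piSchwartzBruhat F ι)) : (ι → AdeleRing (𝓞 F) F) → ℂ) 0 = ℓ a := by
  obtain ⟨κ, _, A, Ψ, hexp⟩ := hM f
  refine ⟨∑ j, ((Ψ j : FinSB F ι) : (ι → FiniteAdeleRing (𝓞 F) F) → ℂ) (piFinite F ι 0) •
      ((BoundedContinuousFunction.evalCLM ℂ (piArch F ι (0 : ι → AdeleRing (𝓞 F) F))).comp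
        ((SchwartzMap.toBoundedContinuousFunctionCLM ℂ (ι → mixedSpace F) ℂ).comp (A j))), fun a => ?_⟩
  rw [hexp, AddSubmonoidClass.coe_finsetSum, Finset.sum_apply]
  simp only [FunLike.coe_sum, FunLike.coe_smul, ContinuousLinearMap.coe_comp, Finset.sum_apply, Pi.smul_apply,
    Function.comp_apply, BoundedContinuousFunction.evalCLM_apply, SchwartzMap.toBoundedContinuousFunctionCLM_apply, smul_eq_mul]
  refine Finset.sum_congr rfl fun j _ => ?_
  rw [coe_piSchwartzBruhatEquiv_tmul_apply, mul_comm]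

end Generic

/-! ## §2 The Siegel–Weil section along an archimedean translate -/

section Doubled

variable (L : Type) [Field L] [NumberField L] [IsCMField L]

variable {N M n : ℕ} (e : Fin N × Fin M ≃ Fin n)
  (dV : Fin N → L) (hdV : ∀ i, IsCMField.complexConj L (dV i) = dV i) (hdV0 : ∀ i, dV i ≠ 0)
  (dW : Fin M → L) (hdW : ∀ i, IsCMField.complexConj L (dW i) = dW i) (hdW0 : ∀ i, dW i ≠ 0)

/-- `(ω(X)(c • Ψ))(0) = c · (ω(X) Ψ)(0)` (linearity of the Weil operator, read at the origin). [cite: GelbartRogawski1991, §3.1 Prop. 3.1.1 p. 455] -/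
theorem opD_smul_apply (X : MpD L e dV hdV dW hdW) (c : ℂ) (Ψ : piSchwartzBruhat (Fp L) (Fin (n + n)))
    (x : Fin (n + n) → AdeleRing (𝓞 (Fp L)) (Fp L)) :
    opD L e dV hdV dW hdW X (c • Ψ) x = c * opD L e dV hdV dW hdW X Ψ x := by
  show (((adelicMpCont.omega (Fp L) (Fin (n + n)) (gramDA L e dV hdV dW hdW) X (c • Ψ)) : piSchwartzBruhat (Fp L) (Fin (n + n))) :
      (Fin (n + n) → AdeleRing (𝓞 (Fp L)) (Fp L)) → ℂ) x = c * _
  rw [map_smul, Submodule.coe_smul, Pi.smul_apply, smul_eq_mul]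

/-- **`f_{a ⊗ f}(h · k) = η_t(k) · (ω(r_F(δ) · sD h)((Cₖ a) ⊗ f))(0)`**: the Siegel–Weil section along the archimedean translate `k ∈ H(L⁺ ⊗ ℝ)`, for ANY
`χ`-normalised doubled Weil representation `sD`, is the explicit scalar `η_t(k)` times the Weil operator of `r_F(δ) · sD h` applied to the pure tensor
`(Cₖ a) ⊗ f`, `Cₖ = e_D^* (archWeilSectionS k).1.2 e_{D*}` Folland's section in the scaled frame (★ `sD.map_mul`, ★ `opD_mul`, ★ `omega_sD_archToAdelic_tmul`).
[cite: GelbartRogawski1991, §3.1 Prop. 3.1.1 p. 455] [cite: KudlaRallis1994, §1] [cite: Paul1998, §1.2 (1.2.1)–(1.2.2) p. 389] -/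
theorem swSection_tmul_mul_archToAdelic {χ : HeckeCharacter L} (hχu : χ.IsUnitary) (hχs : IsSplittingChar L 1 χ)
    {sD : HA L e dV hdV dW hdW →* MpD L e dV hdV dW hdW} (hsD : IsDoubledWeilRep L e dV hdV hdV0 dW hdW hdW0 χ sD)
    {t : InfinitePlace L → ℤ} (ht : χ.HasUnitaryArchType t 0) (hodd : ∀ w, Odd (t w)) (h : HA L e dV hdV dW hdW)
    (k : UnitaryGroup.arch (Fp L) L (IsCMField.complexConj L) (n + n) (hermD L e dV hdV dW hdW))
    (a : 𝓢((Fin (n + n) → mixedSpace (Fp L)), ℂ)) (f : FinSB (Fp L) (Fin (n + n))) :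
    swSection L e dV hdV hdV0 dW hdW hdW0 sD (piSchwartzBruhatEquiv (Fp L) (Fin (n + n)) (a ⊗ₜ f))
        (h * K2LiuArchOneParameterOrbitDefs.archEmb (Fp L) L (IsCMField.complexConj L) (n + n) (hermD L e dV hdV dW hdW) k) =
      (((etaD L e dV hdV dW hdW t k : ℂˣ) : ℂ)) *
        opD L e dV hdV dW hdW (rDelta L e dV hdV hdV0 dW hdW hdW0 * sD h)
          (piSchwartzBruhatEquiv (Fp L) (Fin (n + n))
            (carrierConjEquiv
                (scaledFrame (Fp L) (Fin (n + n))
                  (placeScale (n + n) fun v => sqrtAbs (signVec (cmPlaceOver L)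
                    (fun k => Sum.elim (cmGramEntry L e dV hdV dW hdW) (-cmGramEntry L e dV hdV dW hdW) ((LocalSplitting.e₂ n).symm k))
                    (imagUnit L) v))
                  (placeScale_ne_zero (n + n) (sqrtAbs_signVec_ne_zero (IsCMField.complexConj_ne_one L) (cmPlaceOver_smul L)
                    (complexConj_imagUnit L) (imagUnit_ne_zero L) (gramD_gram_realDiagonal_entry_ne_zero L e dV hdV dW hdW hdV0 hdW0))))
                (archWeilSectionS L (IsCMField.complexConj L) (n + n) (IsCMField.complexConj_ne_one L) (cmPlaceOver L) (cmPlaceOver_smul L)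
                  (cmPlaceOver_comap L) _ (gramD_gram_realDiagonal_entry_ne_zero L e dV hdV dW hdW hdV0 hdW0)
                  (gramD_eq_diagonal_cm L e dV hdV dW hdW) (J := hermD L e dV hdV dW hdW) rfl (complexConj_imagUnit L) (imagUnit_ne_zero L)
                  k).1.2 a ⊗ₜ f)) 0 := by
  -- term-mode group algebra in `Mp(𝕎^𝔻)ᶜᵒⁿᵗ` (cf. ★ `isSiegelDeltaSection_swSection`): `r·sD(h k) = (r·sD h)·sD k`
  have hfac : rDelta L e dV hdV hdV0 dW hdW hdW0 * sD (h * K2LiuArchOneParameterOrbitDefs.archEmb (Fp L) L (IsCMField.complexConj L) (n + n)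
        (hermD L e dV hdV dW hdW) k) =
      rDelta L e dV hdV hdV0 dW hdW hdW0 * sD h *
        sD (K2LiuArchOneParameterOrbitDefs.archEmb (Fp L) L (IsCMField.complexConj L) (n + n) (hermD L e dV hdV dW hdW) k) :=
    (congrArg (rDelta L e dV hdV hdV0 dW hdW hdW0 * ·) (sD.map_mul h _)).trans (mul_assoc _ _ _).symm
  -- `ω` is a representation
  have hop := opD_mul L e dV hdV dW hdW (rDelta L e dV hdV hdV0 dW hdW hdW0 * sD h)
    (sD (K2LiuArchOneParameterOrbitDefs.archEmb (Fp L) L (IsCMField.complexConj L) (n + n) (hermD L e dV hdV dW hdW) k))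
    (piSchwartzBruhatEquiv (Fp L) (Fin (n + n)) (a ⊗ₜ f))
  -- the archimedean operator on the pure tensor (★ p858249; `archEmb k = archToAdelic k` definitionally)
  have hω : adelicMpCont.omega (Fp L) (Fin (n + n)) (gramDA L e dV hdV dW hdW)
      (sD (K2LiuArchOneParameterOrbitDefs.archEmb (Fp L) L (IsCMField.complexConj L) (n + n) (hermD L e dV hdV dW hdW) k))
      (piSchwartzBruhatEquiv (Fp L) (Fin (n + n)) (a ⊗ₜ f)) = _ :=
    omega_sD_archToAdelic_tmul L e dV hdV hdV0 dW hdW hdW0 hχu hχs hsD ht hodd k a f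
  show opD L e dV hdV dW hdW (rDelta L e dV hdV hdV0 dW hdW hdW0 * sD (h * K2LiuArchOneParameterOrbitDefs.archEmb (Fp L) L
      (IsCMField.complexConj L) (n + n) (hermD L e dV hdV dW hdW) k)) (piSchwartzBruhatEquiv (Fp L) (Fin (n + n)) (a ⊗ₜ f)) 0 = _
  rw [hfac, hop]
  -- no rewriting inside `Mp(𝕎^𝔻)ᶜᵒⁿᵗ`: push `hω` through `Ψ ↦ (ω(X) Ψ)(0)` by `congrArg`
  exact (congrArg (fun Ψ : piSchwartzBruhat (Fp L) (Fin (n + n)) => opD L e dV hdV dW hdW (rDelta L e dV hdV hdV0 dW hdW hdW0 * sD h) Ψ 0) hω).trans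
    (opD_smul_apply L e dV hdV dW hdW _ _ _ 0)

/-- **ONE CONTINUOUS LINEAR FUNCTIONAL `ℓ_{h,f}` READS ALL ARCHIMEDEAN TRANSLATES**: for `sD`, `χ`, `t`, `h`, `f` as above there is a continuous linear
functional `ℓ` on `𝓢(X_∞)` with `swSection sD (a ⊗ f) (h · k) = η_t(k) · ℓ (Cₖ a)` for EVERY `k ∈ H(L⁺ ⊗ ℝ)` and every `a ∈ 𝓢(X_∞)` (§1 for the
LF-continuous operator `ω(r_F(δ) · sD h)`, ★ `adelicMpCont.isLFContinuous_omega`).  This is the scalar shell of W4-ii: differentiability of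
`t ↦ f_{a ⊗ f}(h · k(t))` is that of the character `η_t ∘ k` and of `t ↦ ℓ (C_{k(t)} a)`. [cite: Weil1964, Chap. I n° 11, Chap. III n° 39 p. 189]
[cite: GelbartRogawski1991, §3.1 Prop. 3.1.1 p. 455] [cite: KudlaRallis1994, §1] -/
theorem exists_clm_swSection_tmul_mul_archToAdelic {χ : HeckeCharacter L} (hχu : χ.IsUnitary) (hχs : IsSplittingChar L 1 χ)
    {sD : HA L e dV hdV dW hdW →* MpD L e dV hdV dW hdW} (hsD : IsDoubledWeilRep L e dV hdV hdV0 dW hdW hdW0 χ sD)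
    {t : InfinitePlace L → ℤ} (ht : χ.HasUnitaryArchType t 0) (hodd : ∀ w, Odd (t w)) (h : HA L e dV hdV dW hdW)
    (f : FinSB (Fp L) (Fin (n + n))) :
    ∃ ℓ : 𝓢((Fin (n + n) → mixedSpace (Fp L)), ℂ) →L[ℂ] ℂ,
      ∀ (k : UnitaryGroup.arch (Fp L) L (IsCMField.complexConj L) (n + n) (hermD L e dV hdV dW hdW))
        (a : 𝓢((Fin (n + n) → mixedSpace (Fp L)), ℂ)),
        swSection L e dV hdV hdV0 dW hdW hdW0 sD (piSchwartzBruhatEquiv (Fp L) (Fin (n + n)) (a ⊗ₜ f))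
            (h * K2LiuArchOneParameterOrbitDefs.archEmb (Fp L) L (IsCMField.complexConj L) (n + n) (hermD L e dV hdV dW hdW) k) =
          (((etaD L e dV hdV dW hdW t k : ℂˣ) : ℂ)) *
            ℓ (carrierConjEquiv
                (scaledFrame (Fp L) (Fin (n + n))
                  (placeScale (n + n) fun v => sqrtAbs (signVec (cmPlaceOver L)
                    (fun k => Sum.elim (cmGramEntry L e dV hdV dW hdW) (-cmGramEntry L e dV hdV dW hdW) ((LocalSplitting.e₂ n).symm k))
                    (imagUnit L) v))
                  (placeScale_ne_zero (n + n) (sqrtAbs_signVec_ne_zero (IsCMField.complexConj_ne_one L) (cmPlaceOver_smul L)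
                    (complexConj_imagUnit L) (imagUnit_ne_zero L) (gramD_gram_realDiagonal_entry_ne_zero L e dV hdV dW hdW hdV0 hdW0))))
                (archWeilSectionS L (IsCMField.complexConj L) (n + n) (IsCMField.complexConj_ne_one L) (cmPlaceOver L) (cmPlaceOver_smul L)
                  (cmPlaceOver_comap L) _ (gramD_gram_realDiagonal_entry_ne_zero L e dV hdV dW hdW hdV0 hdW0)
                  (gramD_eq_diagonal_cm L e dV hdV dW hdW) (J := hermD L e dV hdV dW hdW) rfl (complexConj_imagUnit L) (imagUnit_ne_zero L)
                  k).1.2 a) := by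
  obtain ⟨ℓ, hℓ⟩ := exists_clm_eval_zero_tmul
    (adelicMpCont.isLFContinuous_omega (rDelta L e dV hdV hdV0 dW hdW hdW0 * sD h)) f
  refine ⟨ℓ, fun k a => ?_⟩
  rw [swSection_tmul_mul_archToAdelic L e dV hdV hdV0 dW hdW hdW0 hχu hχs hsD ht hodd h k a f, ← hℓ]

end Doubled

end Summit.HodgeConjecture.HodgeConjecture.Cruxes.HLiu418.K2LiuSwSectionArchOrbit

end
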